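import Summits.QuantumFields.YangMills.Theorems.BalabanUVNodesN07AtRecord13CoPR

/-!
# BalabanUVNodes ∕ N07 ([Balaban1985Variational], `Dag.B11_main`) AT THE v1.6 SEPARATED-RANGE RECORD `IsRecordOfRecord₁₃CSepCoPR` — N07's conjunct shapes of the route's
# rev-22 K texts (K0⁶ `Record13SepCoPRInhabited`, K1⁶ `StabilityBAtRecordR13SepCoPR`: presenting parameter `θ : Stage13RParams F 2`, key `h : θ.Provisos₁₃SepCoPR F 2`, guard
# `θ.ZrUnity F 2 ∧ θ.SlotsNondegenerate₁₃ F 2`), one storey up from this seat's CoPR-core faces `BalabanUVNodesN07AtRecord13CoPR` — Track A, DAG node N07 = Commun. Math. Phys.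
# **102** (1985) 277–309, Thm 1 p. 279 + Props 2–9 pp. 281–309; seat `pub-ymgap-dag-n07-a` (KNIT-BY-NAME, s2 «knit at the newest record»), generation 9, module 2, 2026-08-27.

WHY THIS FILE.  The rev-22 K texts (plan g69, pressed 12:13Z on def-T FILE 26T p529780) quantify `∃ θ : Stage13RParams F 2, θ.Provisos₁₃SepCoPR F 2 ∧ (θ.ZrUnity F 2 ∧ θ.SlotsNondegenerate₁₃ F 2) ∧
θ.Admissible F 2` (K0⁶ body = K1⁶ antecedent) and conclude at `datumOfRecord₁₃SepCoPR F 2 θ h`; module 1 (`…N07AtRecord13CoPR`) serves N07's guarded ∃-faces at the CoPR CORE key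
(`Provisos₁₃CoPR`, reached from the K texts along `.toCore ∕ .toCoPR`) and the SepCoPR twin at a GIVEN θ (`exists_record₁₃CSepCoPR_b11_main_of_leaf`).  THIS module adds the three
SepCoPR-keyed ∃-faces a K1⁶ knitter applies WITHOUT projecting: N07's reading of the SepCoPR-record class inhabited at `F` (`exists_isRecordOfRecord₁₃CSepCoPR_b11_main_of_leaf`), and
N07's conjunct of the K1⁶ consequent from the K1⁶ antecedent VERBATIM plus the [B11] leaf at SOME residual layer `ζ` (`exists_guarded_record₁₃CSepCoPR_b11_main_of_inhabited13SepCoPR`,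
`…_two`) — N07 ALONE (the K1⁶ stub wants ALL nodes at one world: dag-n24-c's engine; these are the N07 share in its currency).
CONTENT consumed BY NAME, nothing restated — def-T FILE 26T (`IsRecordOfRecord₁₃CSepCoPR`, its ∃-shape), module 1's `exists_record₁₃CSepCoPR_b11_main_of_leaf`, dag-n22-b's
`exists_junkOps_b9LeafX_Y9OfRecord`, `CarriersW.nonempty_residW`.  THEOREMS ONLY (0 `def`, 0 `sorry`, 0 `instance`, standard axioms); COUNT-NEUTRAL; filed
`--kind proof --supports stmt-QuantumFields-20507 --as helper` (K1⁶ `StabilityBAtRecordR13SepCoPR`, route rev 22 — dag-lead WORDS-142; a helper link, not a stub body).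
HONEST FRAMING.  Kernel bookkeeping BY NAME; NO estimate of [Balaban1985Variational] proved here; Theorem 1 for `k ≥ 1` is proved NOWHERE in the tree (GAPS G₈a-1∕2); the [B11] leaf
is a DISPLAYED hypothesis; the K0⁶ body ∕ K1⁶ antecedent is a DISPLAYED hypothesis (neither proved nor refuted here); NOT a discharge of N07 (5∕27 untouched); one finite 𝕋⁴ programme at
fixed `ε` — NOT ℝ⁴ ∕ OS ∕ mass gap ∕ Clay. -/

noncomputable section

namespace Summit.QuantumFields.YangMills.BalabanUVNodes.N07AtRecord13CoPRSep

open Literature.MathematicalPhysics.QuantumFieldTheory.Balaban1983to89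
open Literature.MathematicalPhysics.QuantumFieldTheory.Balaban1983to89.T4Continuum (T4Family FiniteEpsData)
open Literature.MathematicalPhysics.QuantumFieldTheory.Balaban1983to89.DagBinding
open Literature.MathematicalPhysics.QuantumFieldTheory.Balaban1983to89.Node00
open YMDAG.UVSplit (RecordPred Datum AtRecord S_N07)
open Summit.QuantumFields.YangMills.BalabanUVNodes.N06AtRecord9CB10Y (exists_junkOps_b9LeafX_Y9OfRecord)
open Summit.QuantumFields.YangMills.BalabanUVNodes.N07AtRecord13CoPR (exists_record₁₃CSepCoPR_b11_main_of_leaf b11_main_iff_leaves_of_isRecordOfRecord₁₃CSepCoPR)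
open scoped Matrix.Norms.L2Operator

variable {N : ℕ} [NeZero N] {F : T4Family} {D : FiniteEpsData F (Node00.SU N)} {w : WorldP}

/-- **`S_N07` over the v1.6 SEPARATED-RANGE record predicate IS «`b8 → b9 → b11` at every run of every ₁₃CSepCoPR record»** (module 1's reading along `.toCoPR`). [cite: Balaban1985Variational, Thm 1 p.279, Props 2–9 pp.281–309 (bookkeeping: the node at a record)] -/
theorem s_N07_iff_leaves₁₃CSepCoPR : S_N07 (fun F D w => IsRecordOfRecord₁₃CSepCoPR F N D w) ↔
      ∀ (F : T4Family) (D : Datum F N) (w : WorldP), IsRecordOfRecord₁₃CSepCoPR F N D w →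
        ∀ P : B12.RunParams, (leavesP w P).b8 → (leavesP w P).b9 → (leavesP w P).b11 :=
  ⟨fun h F D w hR P => (b11_main_iff_leaves_of_isRecordOfRecord₁₃CSepCoPR hR P).1 (h F D w hR P),
    fun h F D w hR P => (b11_main_iff_leaves_of_isRecordOfRecord₁₃CSepCoPR hR P).2 (h F D w hR P)⟩

/-- ★ **THE ∃-FORM SERVED AT THE SEPARATED-RANGE PIN, N07's CONJUNCT**: if the ₁₃CSepCoPR record class is inhabited at `F` (`∃ D w, IsRecordOfRecord₁₃CSepCoPR F N D w`; HYPOTHESIS) and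
the [B11] leaf holds at the bundle of record of SOME `ζ`, then SOME ₁₃CSepCoPR record `(D, w′)` — the given datum, its world RE-BOUND to the four-pin CoPR view presenting `ζ` (floor `0`,
junk `ops`, any [IV] layer) — carries `Dag.B11_main` at every run.  N07 ALONE. [cite: Balaban1985Variational, Thm 1 p.279, Props 2–9 pp.281–309; Balaban1989LargeFieldII, Thm 1 + (0.1) pp.355–356 (bookkeeping)] -/
theorem exists_isRecordOfRecord₁₃CSepCoPR_b11_main_of_leaf (F : T4Family) (hK0 : ∃ (D : Datum F N) (w : WorldP), IsRecordOfRecord₁₃CSepCoPR F N D w)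
    (ζ : ResidZ F N) (hleaf : B11Leaf (Z11OfRecord F N ζ)) :
    ∃ (D : Datum F N) (w : WorldP), IsRecordOfRecord₁₃CSepCoPR F N D w ∧ ∀ P : B12.RunParams, Dag.B11_main (leavesP w P) := by
  obtain ⟨D, w, θ, h, hθ, hD, -, hγ, -⟩ := hK0
  obtain ⟨ops, -, -⟩ := exists_junkOps_b9LeafX_Y9OfRecord (N := N) θ.toStage3Params hθ.1.1.1.1.1.1 0
  obtain ⟨lamW⟩ := nonempty_residW F N
  obtain ⟨w', hR, -, -, -, hN⟩ := exists_record₁₃CSepCoPR_b11_main_of_leaf θ h hθ (γw := w.γ) hγ 0 ops ζ lamW hleaf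
  exact ⟨D, w', hD ▸ hR, hN⟩

/-- ★ **N07's CONJUNCT SHAPE OF THE rev-22 K TEXTS, WITNESSED AT `θ` ITSELF**: from the K0⁶ body ∕ K1⁶ antecedent at the family — «∃ θ : Stage13RParams F N, Provisos₁₃SepCoPR ∧ (ZrUnity ∧
SlotsNondegenerate₁₃) ∧ Admissible» (HYPOTHESIS) — and the [B11] leaf at SOME `ζ`: a θ with the separated-range provisos, the v1.6 guard and admissibility (read AT `θ`) and a ₁₃CSepCoPR
record of `datumOfRecord₁₃SepCoPR F N θ h` carrying N07 at every run (junk operator layer, floor `0`, any [IV] layer, window `γ = θ.γ`).  NOT the stub (ALL nodes at one world), NOT a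
discharge. [cite: Balaban1985Variational, Thm 1 p.279, Props 2–9 pp.281–309; Balaban1988Convergent, (2.23)–(2.42) pp.259–262, (3.16)–(3.22) pp.268–269 (the separated ranges and the guard; bookkeeping)] -/
theorem exists_guarded_record₁₃CSepCoPR_b11_main_of_inhabited13SepCoPR
    (hK0 : ∃ θ : Stage13RParams F N, θ.Provisos₁₃SepCoPR F N ∧ (θ.ZrUnity F N ∧ θ.SlotsNondegenerate₁₃ F N) ∧ θ.Admissible F N)
    (ζ : ResidZ F N) (hleaf : B11Leaf (Z11OfRecord F N ζ)) :
    ∃ (θ : Stage13RParams F N) (h : θ.Provisos₁₃SepCoPR F N) (w : WorldP), (θ.ZrUnity F N ∧ θ.SlotsNondegenerate₁₃ F N) ∧ θ.Admissible F N ∧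
      IsRecordOfRecord₁₃CSepCoPR F N (datumOfRecord₁₃SepCoPR F N θ h) w ∧ ∀ P : B12.RunParams, Dag.B11_main (leavesP w P) := by
  obtain ⟨θ, h, hU, hθ⟩ := hK0
  obtain ⟨ops, -, -⟩ := exists_junkOps_b9LeafX_Y9OfRecord (N := N) θ.toStage3Params hθ.1.1.1.1.1.1 0
  obtain ⟨lamW⟩ := nonempty_residW F N
  obtain ⟨w, hR, -, -, -, hN⟩ := exists_record₁₃CSepCoPR_b11_main_of_leaf θ h hθ (γw := θ.γ) ⟨hθ.1.1.1.1.1.2, le_rfl⟩ 0 ops ζ lamW hleaf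
  exact ⟨θ, h, w, hU, hθ, hR, hN⟩

/-- ★ **… at `N = 2` — the K1⁶ antecedent of `StabilityBAtRecordR13SepCoPR` VERBATIM** (route rev 22, plan g69 on def-T FILE 26T) gives, with the [B11] leaf at SOME `ζ`, the N07 conjunct
of the K1⁶ consequent's record clause: `∃ θ h w, (θ.ZrUnity F 2 ∧ θ.SlotsNondegenerate₁₃ F 2) ∧ θ.Admissible F 2 ∧ IsRecordOfRecord₁₃CSepCoPR F 2 (datumOfRecord₁₃SepCoPR F 2 θ h) w ∧
∀ P, Dag.B11_main (leavesP w P)`.  N07 ALONE; NOT the stub, NOT a discharge. [cite: Balaban1985Variational, Thm 1 p.279, Props 2–9 pp.281–309 (bookkeeping: the node's share of the rung's antecedent-to-record step)] -/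
theorem exists_guarded_record₁₃CSepCoPR_b11_main_of_inhabited13SepCoPR_two (F : T4Family)
    (hK0 : ∃ θ : Stage13RParams F 2, θ.Provisos₁₃SepCoPR F 2 ∧ (θ.ZrUnity F 2 ∧ θ.SlotsNondegenerate₁₃ F 2) ∧ θ.Admissible F 2)
    (ζ : ResidZ F 2) (hleaf : B11Leaf (Z11OfRecord F 2 ζ)) :
    ∃ (θ : Stage13RParams F 2) (h : θ.Provisos₁₃SepCoPR F 2) (w : WorldP), (θ.ZrUnity F 2 ∧ θ.SlotsNondegenerate₁₃ F 2) ∧ θ.Admissible F 2 ∧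
      IsRecordOfRecord₁₃CSepCoPR F 2 (datumOfRecord₁₃SepCoPR F 2 θ h) w ∧ ∀ P : B12.RunParams, Dag.B11_main (leavesP w P) :=
  exists_guarded_record₁₃CSepCoPR_b11_main_of_inhabited13SepCoPR hK0 ζ hleaf

end Summit.QuantumFields.YangMills.BalabanUVNodes.N07AtRecord13CoPRSep

end
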